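import Summits.ValiantsHypothesis.ValiantsHypothesis.Theorems.SymmetroidPencilBasics
import Summits.ValiantsHypothesis.ValiantsHypothesis.Theorems.LacunarySymmetroidMatrixDescartesStubReverse

/-!
# `MatrixDescartes`, line `Lift` — negative calibration: the rank-one rung `Z₊ ≤ 2·card ι` is FALSE at `n = 2`

Crux `stmt-ValiantsHypothesis-18050` (`Theses.LacunarySymmetroid.MatrixDescartes`).  The line `Lift`
(`Cruxes/MatrixDescartes/Lines/Lift.lean`) reduces the crux to `stub_twoSided`: pencils
`X^e • J + ∑ₖ X^{dₖ} • Pₖ` with `Pₖ ⪰ 0` on BOTH sides of the pivot exponent `e` and ONE constant real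
symmetric `J`.  Its first rung (`firstRung_oneSided`, p152277) gives the `K`-free bound `Z₊ ≤ card ι` in the
one-sided sector, and the line card (`Lines/Lift.md`, "A second grading that survives: RANK of the indefinite
letter"; `disprover-wanted: the RANK-ONE rung`) proposed as the next rung the **rank-one law**: if
`J = −w wᵀ` has rank one then `Z₊ ≤ 2·card ι` (`2n` "log-concave bumps"; it holds when the `Pₖ` commute,
in the one-sided sector, for rates `{−a, a}` and `{−a, 0, a}`, and in the tropical limit).

This file certifies in the kernel that the rank-one law is FALSE already at its smallest open case `n = 2`:
the two-sided `2 × 2` pencil with `e = 6`, `J = −w wᵀ`, `w = (0, 200)`, five rank-one PSD terms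
`Pₖ = vₖ vₖᵀ`, `v = ((13,−53), (−78,274), (−20,−29), (−98,88), (−56,12))` at exponents `d = (0,5,6,7,13)`
has `det` alternating in sign at `1/10 < 1/8 < 1/4 < 1 < 2 < 4 < 8`, hence `Z₊ ≥ 6 > 4 = 2n`
(`six_le_card_posRoots_F₂₅`, `not_rankOneLaw_two`).  (Found by the c1 line lead: random search in the
bounded-mass regime of the planar/Minkowski form of the rank-one problem, robustified to a 5.7 % relative
sign margin, integerised; `exp/` of the lead's folder.)  Consequence for the line: the rank grading of `J⁻`
carries NO `K`-free law even at rank one; the honest rank-one rung is `Z₊ ≤ poly(n, K)` (open).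
Harmless to MDR itself (polynomial counts are absorbed by the regime).

[folklore] Elementary; the sign pattern is a `norm_num` certificate at rational points.
-/

-- `Summit.ValiantsHypothesis.ValiantsHypothesis.…` repeats a component by the D-0017 layout
-- (single-conjunct summit), which the `dupNamespace` linter flags; the name is mandated.
set_option linter.dupNamespace false

namespace Summit.ValiantsHypothesis.ValiantsHypothesis.Theorems.LacunarySymmetroidMatrixDescartes

open Summit.ValiantsHypothesis.ValiantsHypothesis.Theorems.SymmetroidDescartes
  (le_card_posRoots_of_alternating)
open scoped BigOperators Matrix
open Polynomial

namespace RankOneWitness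

/-- the five vectors `vₖ` of the rank-one PSD terms `Pₖ = vₖ vₖᵀ` -/
def V₂₅ : Fin 5 → Fin 2 → ℝ := ![![13, -53], ![-78, 274], ![-20, -29], ![-98, 88], ![-56, 12]]

/-- the PSD terms `Pₖ = vₖ vₖᵀ` -/
def P₂₅ (k : Fin 5) : Matrix (Fin 2) (Fin 2) ℝ := Matrix.vecMulVec (V₂₅ k) (V₂₅ k)

/-- their exponents `(0, 5, 6, 7, 13)` (two-sided around the pivot `e = 6`) -/
def d₂₅ : Fin 5 → ℕ := ![0, 5, 6, 7, 13]

/-- the pivot exponent `e = 6` of the constant indefinite letter -/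
def e₂₅ : ℕ := 6

/-- the vector `w = (0, 200)` of the rank-one negative letter `J = −w wᵀ` -/
def w₂₅ : Fin 2 → ℝ := ![0, 200]

/-- the constant symmetric letter `J = −w wᵀ` (rank one, one negative eigenvalue) -/
def J₂₅ : Matrix (Fin 2) (Fin 2) ℝ := -Matrix.vecMulVec w₂₅ w₂₅

/-- the witness pencil `F(X) = X^6 • J + ∑ₖ X^{dₖ} • Pₖ`, in the currency of `stub_twoSided` -/
noncomputable def F₂₅ : Matrix (Fin 2) (Fin 2) ℝ[X] :=
  ((X : ℝ[X]) ^ e₂₅) • J₂₅.map Polynomial.C + ∑ k, ((X : ℝ[X]) ^ d₂₅ k) • (P₂₅ k).map Polynomial.C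

/-- `J` is symmetric -/
theorem J₂₅_isSymm : J₂₅.IsSymm := by
  unfold Matrix.IsSymm J₂₅ w₂₅
  ext i j
  fin_cases i <;> fin_cases j <;> simp

/-- every `Pₖ = vₖ vₖᵀ` is positive semidefinite -/
theorem P₂₅_posSemidef (k : Fin 5) : (P₂₅ k).PosSemidef := by
  have h := Matrix.posSemidef_vecMulVec_self_star (R := ℝ) (V₂₅ k)
  rwa [star_trivial] at h

/-- the witness is genuinely two-sided: PSD exponents on both sides of the pivot -/
theorem twoSided₂₅ : (∃ k, d₂₅ k < e₂₅) ∧ (∃ k, e₂₅ < d₂₅ k) :=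
  ⟨⟨0, by simp [d₂₅, e₂₅]⟩, ⟨4, by simp [d₂₅, e₂₅]⟩⟩

/-- `det F(t)` in closed form -/
theorem eval_det_F₂₅ (t : ℝ) :
    (F₂₅.det).eval t =
      (169 + 6084 * t ^ 5 + 400 * t ^ 6 + 9604 * t ^ 7 + 3136 * t ^ 13) *
          (2809 + 75076 * t ^ 5 - 39159 * t ^ 6 + 7744 * t ^ 7 + 144 * t ^ 13) -
        (-689 - 21372 * t ^ 5 + 580 * t ^ 6 - 8624 * t ^ 7 - 672 * t ^ 13) ^ 2 := by
  unfold F₂₅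
  rw [StubReverse.eval_det_pencil]
  simp [Matrix.det_fin_two, Fin.sum_univ_five, P₂₅, V₂₅, J₂₅, w₂₅, d₂₅, e₂₅]
  ring

/-- seven positive test points -/
noncomputable def τ₂₅ : Fin 7 → ℝ := ![1/10, 1/8, 1/4, 1, 2, 4, 8]

/-- the test points increase -/
theorem τ₂₅_strictMono : StrictMono τ₂₅ := by
  refine Fin.strictMono_iff_lt_succ.2 fun j => ?_
  fin_cases j <;> simp [τ₂₅] <;> norm_num

/-- the test points are positive -/
theorem τ₂₅_pos (j : Fin 7) : 0 < τ₂₅ j := by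
  fin_cases j <;> simp [τ₂₅]

/-- `det F` alternates in sign along the test points (signs `+,−,+,−,+,−,+`; `norm_num` certificate) -/
theorem alt₂₅ (j : Fin 6) :
    (F₂₅.det).eval (τ₂₅ j.castSucc) * (F₂₅.det).eval (τ₂₅ j.succ) < 0 := by
  fin_cases j <;> simp only [eval_det_F₂₅, τ₂₅] <;> simp <;> norm_num

/-- **`Z₊ ≥ 6`** for the rank-one two-sided `2 × 2` witness. -/
theorem six_le_card_posRoots_F₂₅ :
    6 ≤ (F₂₅.det.roots.toFinset.filter (fun t => 0 < t)).card :=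
  le_card_posRoots_of_alternating _ 6 τ₂₅ τ₂₅_strictMono τ₂₅_pos alt₂₅

end RankOneWitness

open RankOneWitness

/-- **The rank-one rung is false at `n = 2`.**  It is NOT true that every two-sided pencil
`X^e • (−w wᵀ) + ∑ₖ X^{dₖ} • Pₖ` (`Pₖ ⪰ 0`, five terms, `2 × 2`) has at most `2 · 2` distinct positive zeros
of its determinant: the witness `F₂₅` has at least `6`. -/
theorem not_rankOneLaw_two : ¬ ∀ (e : ℕ) (d : Fin 5 → ℕ) (w : Fin 2 → ℝ) (P : Fin 5 → Matrix (Fin 2) (Fin 2) ℝ), (∀ k, (P k).PosSemidef) → ((Matrix.det (((Polynomial.X : Polynomial ℝ) ^ e) • (-Matrix.vecMulVec w w).map Polynomial.C + ∑ k, ((Polynomial.X : Polynomial ℝ) ^ d k) • (P k).map Polynomial.C)).roots.toFinset.filter (fun t => 0 < t)).card ≤ 2 * 2 := by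
  intro h
  have h6 := six_le_card_posRoots_F₂₅.trans (h e₂₅ d₂₅ w₂₅ P₂₅ P₂₅_posSemidef)
  omega

/-- The same witness in the exact vocabulary of `stub_twoSided` (`J` symmetric, `Pₖ ⪰ 0`, exponents on
both sides of the pivot): a rank-one `J` with MORE than `2 · card ι` positive zeros. -/
theorem exists_twoSided_rankOne_gt_two_mul_card :
    ∃ (e : ℕ) (d : Fin 5 → ℕ) (w : Fin 2 → ℝ) (P : Fin 5 → Matrix (Fin 2) (Fin 2) ℝ),
      (-Matrix.vecMulVec w w).IsSymm ∧ (∀ k, (P k).PosSemidef) ∧ (∃ k, d k < e) ∧ (∃ k, e < d k) ∧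
        2 * Fintype.card (Fin 2) <
          ((Matrix.det (((X : ℝ[X]) ^ e) • (-Matrix.vecMulVec w w).map Polynomial.C
              + ∑ k, ((X : ℝ[X]) ^ d k) • (P k).map Polynomial.C)).roots.toFinset.filter
                (fun t => 0 < t)).card :=
  ⟨e₂₅, d₂₅, w₂₅, P₂₅, J₂₅_isSymm, P₂₅_posSemidef, twoSided₂₅.1, twoSided₂₅.2, by
    have h6 := six_le_card_posRoots_F₂₅
    simp only [Fintype.card_fin]
    exact lt_of_lt_of_le (by norm_num) h6⟩

end Summit.ValiantsHypothesis.ValiantsHypothesis.Theorems.LacunarySymmetroidMatrixDescartes
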